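/-
Copyright (c) 2026. All rights reserved.
Released under Apache 2.0 license as described in the file LICENSE.
-/
import Literature.AlgebraicGeometry.ComplexMultiplication.HyperellipticJacobianSimpleFourfoldQuadraticSubfieldMultiplicities
import HarnessLib

/-!
# `k = ℚ(i)` acts on the CM type of `Y_{4p}` (`p ≡ 3 (mod 4)`) with multiplicities `((p+1)/4, (p−3)/4)` — the quadratic subfield of `E_i × Y_{4p}` (Moonen–Zarhin's case (a) for `p = 7`)

Family `hodge`, cell `pub-hodgecm2` (COR-CM), KEPT Literature lane `lit-deligne-3` (generation 55, file F48; the `ℚ(i)`-analogue of F47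
`HyperellipticJacobianSimpleFourfoldQuadraticSubfieldMultiplicities` (`ℚ(√−2)` on `Y_{40}`, multiplicities `(1,3)`); sequel of F44 §5
(`i = ζ_{4p}^p ∈ L_{4p}`)).  THEOREMS ONLY: no definition, no named fact, no `sorry`, no instance; D-0026 net debt `0`.  Nothing here asserts the
algebraicity of any class; HC_CM is NOT proved.

THE POINT.  F44 proved that for every prime `p ≡ 3 (mod 4)`, `p ≥ 7`, `E_i × Y_{4p}` (the CM elliptic curve of `ℚ(i)` times the simple
`(p−1)/2`-fold `Y_{4p}` of `J_{4p}`) carries an exceptional class on itself, and (§5) that `i = ζ_{4p}^p` lies in the CM field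
`L_{4p} = ℚ(ζ_{4p} − ζ_{4p}^{−1})` of `Y_{4p}` — Moonen–Zarhin's case (a) hypothesis «there exists an embedding `k ↪ End⁰(X₂)`» for `p = 7`.  THIS file
computes HOW `k = ℚ(i)` sits in the CM type: two embeddings `σ, σ'` of `ℚ(ζ_{4p})` agree on `i` iff `e ≡ e' (mod 4)` (§2), so on the lower-half
type `Φ_{4p}` (exponents `e < 2p`) the multiplicities of `k` are `(#{e < 2p : e ≡ 1 (4)}, #{units e < 2p : e ≡ 3 (4)}) = ((p+1)/2, (p−3)/2)` (§1:
the residue `p ≡ 3` is not a unit), and on the type `Ψ_{4p}` of `Y_{4p}` (2-to-1 restriction) **`((p+1)/4, (p−3)/4)`** — for `p = 7`: `(2, 1)` on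
the simple CM threefold `Y_{28}`; for `p = 11`: `(3, 2)` on the fivefold `Y_{44}`.  (Contrast F47: `ℚ(√−2)` on `Y_{40}` has `(1, 3)` and
`B•(E' ⊕ Y_{40}) = D•`; here `B• ≠ D•` on `E_i × Y_{4p}` itself, F44.)

WHAT IS PROVED.
* §1 (private) the unit counts `#{v < 2p : v ≡ 1 (4)} = (p+1)/2`, `#{units v < 2p : v ≡ 3 (4)} = (p−3)/2` in `ℤ/4p` (explicit bijections
  `j ↦ 4j + 1`, `j ↦ 4j + 3`, `j ≠ (p−3)/4`).
* §2 `zetaOf_pow_sq_eq_neg_one` (`i² = −1`), **`apply_zetaOf_pow_eq_iff`** (`σ(i) = σ'(i) ⟺ e ≡ e' (mod 4)`),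
  **`exists_multiplicities_of_level_fourMulPrime_three_mod_four`** (`∃ σ₀ ∈ Φ_{4p}`, `e(σ₀) = 1`: `#{σ ∈ Φ : σ i = σ₀ i} = (p+1)/2`,
  `#{σ ∈ Φ : σ i = −σ₀ i} = (p−3)/2`).
* §3 **`exists_multiplicities_subPair_of_level_fourMulPrime_three_mod_four`** — index-`2` sub-pair `(L; Ψ)`, `Ψ^K = Φ_{4p}`, `i ∈ L`:
  `∃ ρ₀ ∈ Ψ`: `#{ρ ∈ Ψ : ρ i = ρ₀ i} = (p+1)/4`, `#{ρ ∈ Ψ : ρ i = −ρ₀ i} = (p−3)/4`, `ρ₀(i)² = −1`.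

HONEST.  CM-type level only (the action on `T_{Y,0}` through the realisation and `End⁰(Y_{4p}) = L_{4p}` are NOT typed); no numerics; no algebraicity claim.

## References
* [MoonenZarhin1999LowDim] B. Moonen, Yu. Zarhin, Math. Ann. 315 (1999) 711–733: Introduction (a), Thm. 0.1 (1) [corpus: paper:arxiv-math_9901113 p. 1].
  [cite: MoonenZarhin1999LowDim, Introduction (a) and Thm. 0.1 (1)]
* [GalleseGoodsonLombardo2024] Gallese–Goodson–Lombardo, §3 Thm. 3.0 (5), §3.2 Lemma 11. [cite: GalleseGoodsonLombardo2024, §3 Thm. 3.0 (5) and §3.2 Lemma 11]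
* [Shimura1998] G. Shimura (1998), §6.2 Thm. 3. [cite: Shimura1998, §6.2 Thm. 3]
* [Washington1997] L. C. Washington, *Introduction to Cyclotomic Fields*, Thm. 2.5. [cite: Washington1997, Thm. 2.5]
-/

open CategoryTheory CategoryTheory.Limits NumberField Module

namespace Literature.AlgebraicGeometry.ComplexMultiplication

open Literature.AlgebraicGeometry.Motives
open Literature.NumberTheory.ComplexMultiplication

namespace HyperellipticJacobian

open Literature.AlgebraicGeometry.Pohlmann1968 Literature.AlgebraicGeometry.Pohlmann1968.Cyclotomic
open Literature.AlgebraicGeometry.Pohlmann1968.CMAlgebra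

/-! ## §1 Counting the units of `ℤ/4p` below `2p` in a residue class mod `4` (`p ≡ 3 (mod 4)` prime) -/

section Counting

/-- `4j + r` (`r` odd, `4j + r < 2p`, `4j + r ≠ p`) is prime to `4p`. [folklore] -/
private theorem coprime_four_mul_add {p j r : ℕ} (hp : p.Prime) (hr : r % 2 = 1) (hlt : 4 * j + r < 2 * p) (hne : 4 * j + r ≠ p) :
    (4 * j + r).Coprime (4 * p) := by
  refine Nat.coprime_of_dvd fun q hq hqa hqb => ?_
  rcases (Nat.Prime.dvd_mul hq).1 hqb with h4 | hpq
  · have h2 : q ∣ 2 ^ 2 := by simpa using h4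
    have := (Nat.prime_dvd_prime_iff_eq hq Nat.prime_two).1 (Nat.Prime.dvd_of_dvd_pow hq h2)
    subst this
    omega
  · have hqp : q = p := (Nat.prime_dvd_prime_iff_eq hq hp).1 hpq
    subst hqp
    obtain ⟨k, hk⟩ := hqa
    have hk2 : k < 2 := by
      by_contra hk2
      have : q * 2 ≤ q * k := Nat.mul_le_mul_left q (by omega)
      omega
    interval_cases k
    · omega
    · exact hne (by omega)

/-- **`#{units v of ℤ/4p : v < 2p, v ≡ 1 (mod 4)} = (p+1)/2`** for a prime `p ≡ 3 (mod 4)` (`v = 4j + 1`, `0 ≤ j ≤ (p−1)/2`). [folklore] -/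
private theorem card_units_lower_mod_four_eq_one {p : ℕ} [NeZero (4 * p)] (hp : p.Prime) (hp3 : p % 4 = 3) :
    (Finset.univ.filter fun v : ZMod (4 * p) =>
      v.val.Coprime (4 * p) ∧ (2 * v.val < 4 * p ∧ v.val % 4 = 1)).card = (p + 1) / 2 := by
  rw [← Finset.card_range ((p + 1) / 2)]
  symm
  refine Finset.card_bij (fun j _ => ((4 * j + 1 : ℕ) : ZMod (4 * p))) (fun j hj => ?_) (fun j hj j' hj' h => ?_)
    (fun v hv => ?_)
  · rw [Finset.mem_range] at hj
    have hlt : 4 * j + 1 < 4 * p := by omega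
    rw [Finset.mem_filter, ZMod.val_natCast_of_lt hlt]
    exact ⟨Finset.mem_univ _, coprime_four_mul_add hp (by norm_num) (by omega) (by omega), by omega, by omega⟩
  · rw [Finset.mem_range] at hj hj'
    have h1 := congrArg ZMod.val h
    rw [ZMod.val_natCast_of_lt (by omega), ZMod.val_natCast_of_lt (by omega)] at h1
    omega
  · rw [Finset.mem_filter] at hv
    obtain ⟨-, hcop, hlt, hmod⟩ := hv
    refine ⟨v.val / 4, Finset.mem_range.2 (by omega), ?_⟩
    have : 4 * (v.val / 4) + 1 = v.val := by omega
    rw [this, ZMod.natCast_zmod_val]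

/-- **`#{units v of ℤ/4p : v < 2p, v ≡ 3 (mod 4)} = (p−3)/2`** for a prime `p ≡ 3 (mod 4)` (`v = 4j + 3`, `0 ≤ j ≤ (p−3)/2`, `j ≠ (p−3)/4`:
the residue `p` itself is not a unit). [folklore] -/
private theorem card_units_lower_mod_four_eq_three {p : ℕ} [NeZero (4 * p)] (hp : p.Prime) (hp3 : p % 4 = 3) :
    (Finset.univ.filter fun v : ZMod (4 * p) =>
      v.val.Coprime (4 * p) ∧ (2 * v.val < 4 * p ∧ v.val % 4 = 3)).card = (p - 3) / 2 := by
  have hp3' : 3 ≤ p := by have := hp.two_le; omega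
  have hsrc : (((Finset.range ((p - 1) / 2)).erase ((p - 3) / 4)).card) = (p - 3) / 2 := by
    rw [Finset.card_erase_of_mem (Finset.mem_range.2 (by omega)), Finset.card_range]
    omega
  rw [← hsrc]
  symm
  refine Finset.card_bij (fun j _ => ((4 * j + 3 : ℕ) : ZMod (4 * p))) (fun j hj => ?_) (fun j hj j' hj' h => ?_)
    (fun v hv => ?_)
  · rw [Finset.mem_erase, Finset.mem_range] at hj
    have hlt : 4 * j + 3 < 4 * p := by omega
    rw [Finset.mem_filter, ZMod.val_natCast_of_lt hlt]
    exact ⟨Finset.mem_univ _, coprime_four_mul_add hp (by norm_num) (by omega) (by omega), by omega, by omega⟩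
  · rw [Finset.mem_erase, Finset.mem_range] at hj hj'
    have h1 := congrArg ZMod.val h
    rw [ZMod.val_natCast_of_lt (by omega), ZMod.val_natCast_of_lt (by omega)] at h1
    omega
  · rw [Finset.mem_filter] at hv
    obtain ⟨-, hcop, hlt, hmod⟩ := hv
    have hne : v.val ≠ p := by
      intro h
      rw [h] at hcop
      exact hp.one_lt.ne' (Nat.Coprime.eq_one_of_dvd hcop (dvd_mul_left p 4))
    refine ⟨v.val / 4, Finset.mem_erase.2 ⟨by omega, Finset.mem_range.2 (by omega)⟩, ?_⟩
    have : 4 * (v.val / 4) + 3 = v.val := by omega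
    rw [this, ZMod.natCast_zmod_val]

end Counting

/-! ## §2 `ℚ(ζ_{4p})`: two embeddings agree on `i = ζ^p` iff `e ≡ e' (mod 4)`; multiplicities `((p+1)/2, (p−3)/2)` of `ℚ(i)` on `Φ_{4p}` -/

section LevelFourP

variable {N : ℕ} [NeZero N] {K : Type} [Field K] [NumberField K] [IsCyclotomicExtension {N} ℚ K]

/-- `(ζ_{4p}^p)² = −1`. [cite: Washington1997, Ch. 2] -/
theorem zetaOf_pow_sq_eq_neg_one {p : ℕ} (hp : 0 < p) (hN : N = 4 * p) : (zetaOf N K ^ p) ^ 2 = -1 := by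
  have hprim : IsPrimitiveRoot (zetaOf N K) N := IsCyclotomicExtension.zeta_spec N ℚ K
  rw [← pow_mul]
  exact (hprim.pow (by omega) (show N = p * 2 * 2 by omega)).eq_neg_one_of_two_right

/-- **TWO EMBEDDINGS OF `ℚ(ζ_{4p})` AGREE ON `i = ζ^p` IFF `e ≡ e' (mod 4)`** (`σ(ζ^p) = μ^{pe}`, `μ = e^{2πi/4p}` of order `4p`).
[cite: Washington1997, Thm. 2.5] [cite: MoonenZarhin1999LowDim, Introduction (a)] -/
theorem apply_zetaOf_pow_eq_iff {p : ℕ} (hp : 0 < p) (hN : N = 4 * p) (σ σ' : K →+* ℂ) :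
    σ (zetaOf N K ^ p) = σ' (zetaOf N K ^ p) ↔ (expOf N K σ).val % 4 = (expOf N K σ').val % 4 := by
  subst hN
  have hμ : IsPrimitiveRoot (rootζ (4 * p)) (4 * p) := by
    simpa [rootζ] using Complex.isPrimitiveRoot_exp (4 * p) (NeZero.ne (4 * p))
  have hred : ∀ n : ℕ, rootζ (4 * p) ^ n = rootζ (4 * p) ^ (n % (4 * p)) := fun n => by
    conv_lhs => rw [← Nat.mod_add_div n (4 * p), pow_add, pow_mul, hμ.pow_eq_one, one_pow, mul_one]
  have hiff : ∀ a b : ℕ, rootζ (4 * p) ^ a = rootζ (4 * p) ^ b ↔ a % (4 * p) = b % (4 * p) := fun a b => by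
    rw [hred a, hred b]
    exact ⟨fun h => hμ.pow_inj (Nat.mod_lt _ (by omega)) (Nat.mod_lt _ (by omega)) h, fun h => by rw [h]⟩
  rw [map_pow, map_pow, expOf_spec (4 * p) K σ, expOf_spec (4 * p) K σ', ← pow_mul, ← pow_mul, hiff,
    Nat.mul_mod_mul_right, Nat.mul_mod_mul_right]
  exact ⟨fun h => Nat.eq_of_mul_eq_mul_right hp h, fun h => by rw [h]⟩

/-- Counting embeddings of `ℚ(ζ_N)` by their exponents. [cite: Washington1997, Thm. 2.5] -/
private theorem card_filter_expOf'' (P : ZMod N → Prop) [DecidablePred P] :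
    (Finset.univ.filter fun σ : K →+* ℂ => P (expOf N K σ)).card =
      (Finset.univ.filter fun v : ZMod N => v.val.Coprime N ∧ P v).card := by
  rw [← Finset.card_image_of_injective (Finset.univ.filter fun σ : K →+* ℂ => P (expOf N K σ)) (expOf_injective N K)]
  congr 1
  ext v
  simp only [Finset.mem_image, Finset.mem_filter, Finset.mem_univ, true_and]
  constructor
  · rintro ⟨σ, hσ, rfl⟩
    exact ⟨coprime_expOf N K σ, hσ⟩
  · rintro ⟨hv, hP⟩
    obtain ⟨σ, hσ⟩ := exists_expOf_eq N K v hv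
    exact ⟨σ, by rw [hσ]; exact hP, hσ⟩

/-- A residue prime to `4p` is odd: `v mod 4 ≠ 1 ⟺ v mod 4 = 3`. [folklore] -/
private theorem mod_four_ne_one_iff {p v : ℕ} (h : v.Coprime (4 * p)) : ¬v % 4 = 1 ↔ v % 4 = 3 := by
  have hodd : v % 2 = 1 := by
    by_contra hv
    have := Nat.dvd_gcd (show 2 ∣ v by omega) (show 2 ∣ 4 * p from ⟨2 * p, by ring⟩)
    rw [h] at this
    omega
  omega

/-- **MULTIPLICITIES `((p+1)/2, (p−3)/2)` OF `k = ℚ(i)` ON THE CM TYPE `Φ_{4p}` OF `X_{4p} ∼ Y_{4p}²`** (`p ≡ 3 (mod 4)` prime, `i = ζ_{4p}^p`,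
`i² = −1`): with `σ₀ ∈ Φ_{4p}` of exponent `1`, exactly `(p+1)/2` members of the lower-half type send `i ↦ σ₀(i)` (exponents `≡ 1 (mod 4)`
below `2p`) and exactly `(p−3)/2` send `i ↦ −σ₀(i)` (exponents `≡ 3 (mod 4)` below `2p`, the non-unit `p` excluded).  For `p = 7`: `(4, 2)` on
`X_{28} ∼ Y_{28}²`. [cite: MoonenZarhin1999LowDim, Introduction (a) and Thm. 0.1 (1)] [cite: GalleseGoodsonLombardo2024, §3 Thm. 3.0 (5) and §3.2 Lemma 11]
[cite: Washington1997, Thm. 2.5] -/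
theorem exists_multiplicities_of_level_fourMulPrime_three_mod_four {p : ℕ} (hp : p.Prime) (hp3 : p % 4 = 3) (hN : N = 4 * p)
    (Φ : CMType K) (hΦ : ∀ σ : K →+* ℂ, σ ∈ Φ.1 ↔ 2 * (expOf N K σ).val < N) :
    ∃ σ₀ : K →+* ℂ, σ₀ ∈ Φ.1 ∧ (expOf N K σ₀).val = 1 ∧
      {σ | σ ∈ Φ.1 ∧ σ (zetaOf N K ^ p) = σ₀ (zetaOf N K ^ p)}.ncard = (p + 1) / 2 ∧
      {σ | σ ∈ Φ.1 ∧ σ (zetaOf N K ^ p) = -σ₀ (zetaOf N K ^ p)}.ncard = (p - 3) / 2 := by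
  classical
  have hp0 : 0 < p := hp.pos
  have hsq := zetaOf_pow_sq_eq_neg_one (K := K) hp0 hN
  have hagree := apply_zetaOf_pow_eq_iff (K := K) hp0 hN
  subst hN
  obtain ⟨σ₀, hσ₀⟩ := exists_expOf_eq (4 * p) K (1 : ZMod (4 * p))
    (by rw [ZMod.val_one_eq_one_mod, Nat.mod_eq_of_lt (by omega)]; exact Nat.coprime_one_left _)
  have h1 : (expOf (4 * p) K σ₀).val = 1 := by rw [hσ₀, ZMod.val_one_eq_one_mod, Nat.mod_eq_of_lt (by omega)]
  have hmem : σ₀ ∈ Φ.1 := by rw [hΦ, h1]; omega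
  set w := zetaOf (4 * p) K ^ p with hw
  have hw0 : σ₀ w ≠ 0 := by
    intro h
    have := congrArg (· ^ 2) h
    simp only [← map_pow, hsq, map_neg, map_one, ne_eq, OfNat.ofNat_ne_zero, not_false_eq_true, zero_pow] at this
    norm_num at this
  have hneg : ∀ σ : K →+* ℂ, σ w = -σ₀ w ↔ ¬σ w = σ₀ w := fun σ => by
    constructor
    · intro h h'
      apply hw0
      have : σ₀ w = -σ₀ w := h'.symm.trans h
      linear_combination this / 2
    · intro h
      have hsq' : (σ w) ^ 2 = (σ₀ w) ^ 2 := by rw [← map_pow, ← map_pow, hsq, map_neg, map_neg, map_one, map_one]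
      rcases eq_or_eq_neg_of_sq_eq_sq _ _ hsq' with h' | h'
      · exact absurd h' h
      · exact h'
  have e1 : {σ | σ ∈ Φ.1 ∧ σ w = σ₀ w} = ↑(Finset.univ.filter fun σ : K →+* ℂ =>
      2 * (expOf (4 * p) K σ).val < 4 * p ∧ (expOf (4 * p) K σ).val % 4 = 1) := by
    ext σ
    rw [Set.mem_setOf_eq, Finset.coe_filter, Set.mem_setOf_eq, hΦ, hagree σ σ₀, h1]
    simp only [Finset.mem_univ, true_and]
  have e2 : {σ | σ ∈ Φ.1 ∧ σ w = -σ₀ w} = ↑(Finset.univ.filter fun σ : K →+* ℂ =>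
      2 * (expOf (4 * p) K σ).val < 4 * p ∧ ¬(expOf (4 * p) K σ).val % 4 = 1) := by
    ext σ
    rw [Set.mem_setOf_eq, Finset.coe_filter, Set.mem_setOf_eq, hΦ, hneg σ, hagree σ σ₀, h1]
    simp only [Finset.mem_univ, true_and]
  refine ⟨σ₀, hmem, h1, ?_, ?_⟩
  · rw [e1, Set.ncard_coe_finset,
      card_filter_expOf'' (K := K) (P := fun v : ZMod (4 * p) => 2 * v.val < 4 * p ∧ v.val % 4 = 1)]
    exact card_units_lower_mod_four_eq_one hp hp3
  · rw [e2, Set.ncard_coe_finset,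
      card_filter_expOf'' (K := K) (P := fun v : ZMod (4 * p) => 2 * v.val < 4 * p ∧ ¬v.val % 4 = 1)]
    rw [← card_units_lower_mod_four_eq_three (p := p) hp hp3]
    congr 1
    refine Finset.filter_congr fun v _ => ?_
    constructor
    · rintro ⟨hc, hl, hm⟩
      exact ⟨hc, hl, (mod_four_ne_one_iff hc).1 hm⟩
    · rintro ⟨hc, hl, hm⟩
      exact ⟨hc, hl, (mod_four_ne_one_iff hc).2 hm⟩

end LevelFourP

/-! ## §3 On the simple factor `Y_{4p}`: `ℚ(i) ⊂ L_{4p}` acts on `Ψ_{4p}` with multiplicities `((p+1)/4, (p−3)/4)` -/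

section SubPair

variable {N : ℕ} [NeZero N] {K : Type} [Field K] [NumberField K] [IsCyclotomicExtension {N} ℚ K]

/-- Counting through a 2-to-1 restriction: `#{σ ∈ Ψ^K : σ(x) = c} = 2 · #{ρ ∈ Ψ : ρ(x) = c}` for `x ∈ L`, `[K : L] = 2`.
[cite: Shimura1998, §6.2 Thm. 3 (proof)] -/
private theorem ncard_eq_two_mul_ncard' {L : IntermediateField ℚ K} {Ψ : CMType L} {Φ : CMType K}
    (hind : inducedCMType (algebraMap L K) Ψ = Φ) (hfin : Module.finrank L K = 2) (x : L) (c : ℂ) :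
    {σ : K →+* ℂ | σ ∈ Φ.1 ∧ σ (x : K) = c}.ncard = 2 * {ρ : L →+* ℂ | ρ ∈ Ψ.1 ∧ ρ x = c}.ncard := by
  classical
  have h := card_filter_comp_mem (K := K) (L := L) (Finset.univ.filter fun ρ : L →+* ℂ => ρ ∈ Ψ.1 ∧ ρ x = c)
  rw [hfin] at h
  have e1 : {σ : K →+* ℂ | σ ∈ Φ.1 ∧ σ (x : K) = c} = ↑(Finset.univ.filter fun σ : K →+* ℂ =>
      σ.comp (algebraMap L K) ∈ (Finset.univ.filter fun ρ : L →+* ℂ => ρ ∈ Ψ.1 ∧ ρ x = c)) := by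
    ext σ
    simp only [Set.mem_setOf_eq, Finset.coe_filter, Finset.mem_filter, Finset.mem_univ, true_and, RingHom.coe_comp,
      Function.comp_apply, ← hind, mem_inducedCMType_iff]
    rfl
  have e2 : {ρ : L →+* ℂ | ρ ∈ Ψ.1 ∧ ρ x = c} = ↑(Finset.univ.filter fun ρ : L →+* ℂ => ρ ∈ Ψ.1 ∧ ρ x = c) := by
    ext ρ
    simp only [Set.mem_setOf_eq, Finset.coe_filter, Finset.mem_univ, true_and]
  rw [e1, e2, Set.ncard_coe_finset, Set.ncard_coe_finset, h]

/-- **MULTIPLICITIES `((p+1)/4, (p−3)/4)` OF `ℚ(i)` ON THE CM TYPE OF `Y_{4p}`** (`p ≡ 3 (mod 4)` prime): for the index-`2` sub-pair `(L; Ψ)`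
of `(ℚ(ζ_{4p}); Φ_{4p})` with `Ψ^K = Φ_{4p}` and `i = ζ^p ∈ L` (F44 §5: `ℚ(i) ⊂ L_{4p} = ℚ(ζ_{4p} − ζ_{4p}^{−1})`, the CM field of the simple
factor `Y_{4p}` of dimension `(p−1)/2`): there is `ρ₀ ∈ Ψ` with `#{ρ ∈ Ψ : ρ i = ρ₀ i} = (p+1)/4`, `#{ρ ∈ Ψ : ρ i = −ρ₀ i} = (p−3)/4`,
`ρ₀(i)² = −1` — the imaginary quadratic field `k = ℚ(i)` of `E_i` embeds into the CM field of `Y_{4p}` (Moonen–Zarhin's case (a) hypothesis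
for `p = 7`: `Y_{28}` a simple CM threefold, multiplicities `(2, 1)`) and acts with these multiplicities.
[cite: MoonenZarhin1999LowDim, Introduction (a) and Thm. 0.1 (1)] [cite: GalleseGoodsonLombardo2024, §3 Thm. 3.0 (5) and §3.2 Lemma 11]
[cite: Shimura1998, §6.2 Thm. 3] -/
theorem exists_multiplicities_subPair_of_level_fourMulPrime_three_mod_four {p : ℕ} (hp : p.Prime) (hp3 : p % 4 = 3)
    (hN : N = 4 * p) (Φ : CMType K) (hΦ : ∀ σ : K →+* ℂ, σ ∈ Φ.1 ↔ 2 * (expOf N K σ).val < N)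
    {L : IntermediateField ℚ K} {Ψ : CMType L} (hind : inducedCMType (algebraMap L K) Ψ = Φ) (hfin : Module.finrank L K = 2)
    (hi : zetaOf N K ^ p ∈ L) :
    ∃ ρ₀ : L →+* ℂ, ρ₀ ∈ Ψ.1 ∧
      {ρ | ρ ∈ Ψ.1 ∧ ρ ⟨_, hi⟩ = ρ₀ ⟨_, hi⟩}.ncard = (p + 1) / 4 ∧ {ρ | ρ ∈ Ψ.1 ∧ ρ ⟨_, hi⟩ = -ρ₀ ⟨_, hi⟩}.ncard = (p - 3) / 4 ∧
      (ρ₀ ⟨_, hi⟩) ^ 2 = -1 := by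
  obtain ⟨σ₀, hσ₀, -, hplus, hminus⟩ := exists_multiplicities_of_level_fourMulPrime_three_mod_four hp hp3 hN Φ hΦ
  refine ⟨σ₀.comp (algebraMap L K), by rw [← mem_inducedCMType_iff (algebraMap L K), hind]; exact hσ₀, ?_, ?_, ?_⟩
  · have h := ncard_eq_two_mul_ncard' hind hfin ⟨_, hi⟩ (σ₀ (zetaOf N K ^ p))
    rw [hplus] at h
    have : (σ₀.comp (algebraMap L K)) ⟨_, hi⟩ = σ₀ (zetaOf N K ^ p) := rfl
    rw [this]
    omega
  · have h := ncard_eq_two_mul_ncard' hind hfin ⟨_, hi⟩ (-σ₀ (zetaOf N K ^ p))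
    rw [hminus] at h
    have : (σ₀.comp (algebraMap L K)) ⟨_, hi⟩ = σ₀ (zetaOf N K ^ p) := rfl
    rw [this]
    omega
  · show (σ₀ (algebraMap L K ⟨_, hi⟩)) ^ 2 = -1
    rw [← map_pow, show (algebraMap L K ⟨_, hi⟩ : K) = zetaOf N K ^ p from rfl, zetaOf_pow_sq_eq_neg_one hp.pos hN, map_neg, map_one]

end SubPair

end HyperellipticJacobian

end Literature.AlgebraicGeometry.ComplexMultiplication
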